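import Literature.Analysis.Calculus.ExpDuhamel
import Mathlib

/-!
# Dimock–Yuan: THEOREM 5 (Stability bound) — the end statement of the Gross–Neveu flow paper, `‖S_f‖_h ≤ CC_V g_f`
and `½ ≤ 𝖹 ≤ 3/2` uniformly in `N`, PROVED in its arithmetic from the printed inputs, model-free

**Citation header (reproduction of PUBLISHED work; template file of the Balaban lattice Yang–Mills cell `pub-balaban`,
TEMPLATE.md §16; no manuscript under audit is touched).**
J. Dimock, C. Yuan, *Structural stability of the RG flow in the Gross–Neveu model*, Ann. Henri Poincaré **25** (2024),
doi 10.1007/s00023-024-01427-0 (= arXiv:2303.07916v3) [DimockYuan2024GNFlow], **§5 "Ultraviolet stability bound" of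
arXiv v3** (TeX l. 4091, printed pp. 68–69): the partition function (kumquat context) *"𝖹 = ∫ e^{S_f(ψ)} dμ_{G_f}(ψ)"*
(l. 4100, printed (456)), the final action *"S_f = ∫_□ (−z_N ψ̄∂̸ψ + g_f(ψ̄ψ)² + p_N(ψ̄γ₅ψ)² + v_N(ψ̄γ_μψ)²) + Q_N^{reg} +
Q′_N^{reg} + E_N"* (ll. 4106–4108, printed (458)), **Theorem 5** *"(Stability bound) Under the hypotheses of theorem 1
with parameters chosen as in theorem 4 we have uniformly in N  ‖S_f‖_h ≤ CC_V g_f  (459)  and  ½ ≤ 𝖹 ≤ 3/2  (460)"*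
(ll. 4110–4118) and its PROOF (ll. 4121–4152): *"Since our solution has x ∈ x̄ + ⅛𝓑_{C_E} the bounds (twotwotwo) hold
for all k and so for k = N.  Then as in lemma 4 with |z_N| ≤ C_Z g_f  ‖z_N ∫ψ̄∂̸ψ‖_h ≤ CC_V g_f   ‖g_f ∫(ψ̄ψ)²‖_h ≤ Cg_f
(461)  All the other terms in S_N are higher order and smaller. See in particular (lunar), (lunar1), and (twotwotwo) and
use ‖F‖_h < ‖F‖_{h,Γ₄}  The bound on S_f follows."*; *"For the partition function note that the Fourier coefficients
G̃_f(p) are rapidly decreasing and have no small divisors.  Hence h(G_f) defined as in (sequoia) is bounded by 𝒪(1) and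
we can choose h so h(G_f) ≤ h.  Then ‖S_f‖_{h(G_f)} ≤ ‖S_f‖_h ≤ CC_V g_f.  Now we write  ∫ e^{−S_f} dμ_{G_f} = 1 + ∫
(e^{−S_f} − 1) dμ_{G_f}  (462)  Estimate the last integral as in lemma 7 and get for g_f sufficiently small  |∫ (e^{−S_f}
− 1) dμ_{G_f}| ≤ ‖e^{−S_f} − 1‖_{h(G_f)} ≤ e^{‖S_f‖_{h(G_f)}} − 1 ≤ e^{CC_V g_f} − 1 < ½  (463)  This suffices and
completes the proof."*  ⟦sic: (456) prints `e^{S_f}` and (462)–(463) print `e^{−S_f}` — a sign inconsistency IN PRINT,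
reproduced as printed; the statement below is sign-symmetric (`S ↦ −S` preserves `‖S‖ ≤ c`).⟧  The two inputs named there:
**Lemma 1** \label{product} (ll. 452–461) — after *"The next result shows that under certain conditions on the space 𝒞′ the
space 𝒢_h is a Banach algebra."*: *"Suppose that ‖Alt(F_n ⊗ G_m)‖_{𝒞′} ≤ ‖F_n‖_{𝒞′}‖G_m‖_{𝒞′}  Then if F ∈ 𝒢_h and G ∈ 𝒢_h
then FG ∈ 𝒢_h and ‖FG‖_h ≤ ‖F‖_h‖G‖_h"* (so, under Lemma 1's hypothesis on `𝒞′`, the space `𝒢_h` of the Grassmann algebra is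
a Banach algebra) and **Lemma 7** \label{concert} (ll. 1053–1059) *"For F ∈ 𝒢_{h(C)}  |∫ F dμ_C| ≤ ‖F‖_{h(C)}"*, with `h(C)`
from (sequoia) (l. 1046).
TeX line numbers refer to the arXiv source held by the cell (`inputs/files/dimock/src/2303.07916/2303.07916.tex`);
printed page/equation numbers were read off the arXiv-v3 PDF text layer (cell tool `t4/b2b-balaban-t4-lit2/g10/pdftext.py`).

**What is reproduced here (kernel-checked, zero `sorry`), MODEL-FREE.**  The Grassmann algebra `𝒢_{h(G_f)}` is typed
as an arbitrary real Banach algebra `𝔸` (Lemma 1, under its hypothesis on `𝒞′`, is exactly the statement that it is one),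
the Gaussian Grassmann
integral `∫ · dμ_{G_f}` as a real-linear map `I : 𝔸 →ₗ[ℝ] E` into a normed space with `‖I F‖ ≤ ‖F‖` (Lemma 7) and
`I 1 = 1` (the free normalisation) where needed, the action as an element `S` with `‖S‖ ≤ c` (the proved (459) transported
by `‖S_f‖_{h(G_f)} ≤ ‖S_f‖_h`), and `e^{−S_f}` as `NormedSpace.exp (−S)`.  Then:
* Part 1 — (459)'s bookkeeping `norm_action_le`: a finite sum of terms with `‖T_i‖ ≤ a_i·g` has norm `≤ (Σ a_i)·g`
  (the seven terms of (458) with their per-term constants from (461)/(lunar)/(lunar1)/(twotwotwo) — those bounds are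
  the declared inputs, theorems of §§3–4 in print), and the display (461) `norm_smul_term_le`: `‖z • M‖ ≤ C_Z g·‖M‖`
  for `|z| ≤ C_Z g`;
* Part 2 — (462)–(463) `norm_partition_sub_le`: **`‖I(e^{−S}) − I(1)‖ ≤ e^{‖S‖} − 1 ≤ e^{c} − 1`** (linearity, Lemma 7,
  and `‖e^{−S} − 1‖ ≤ e^{‖S‖} − 1` in any Banach algebra — the tree's `Literature.Analysis.Calculus.norm_exp_sub_one_le`);
* Part 3 — (460) `DimockYuan2024_thm5_stability`: for a REAL-valued integral with `I 1 = 1` and `e^{c} ≤ 3/2`,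
  **`½ ≤ I(e^{−S}) ≤ 3/2`**; the print's *"for g_f sufficiently small"* made EXPLICIT as `CC_V g_f ≤ log(3/2)`
  (`exp_le_three_halves_of_le_log`, `DimockYuan2024_thm5_stability_gf`: `c = C·C_V·g_f`, `0 ≤ g_f ≤ log(3/2)/(C·C_V)`).
* Part 4 — a non-vacuity instance (`𝔸 = ℝ`, `I = id`, `S = c ≥ 0`): the hypotheses are consistent (`pin_real`,
  `pin_real_thm5`: `½ ≤ e^{−c} ≤ 3/2` for `0 ≤ c ≤ log(3/2)`).

**What is NOT claimed.**  Nothing about the Grassmann algebra, the norms `‖·‖_h` / `‖·‖_{h,Γ₄}` or their monotonicity in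
`h`, the per-term bounds (461)/(lunar)/(lunar1)/(twotwotwo), Lemma 7 or (sequoia) — they are the declared hypotheses
(`hI`, `hS`, `h`) and are theorems in print; nothing about Theorems 1–4 beyond what the lineage's sibling leaves
(`QuadraticFlow`, `QuadraticFlowSums`, `FirstLinearEquation`, `SecondLinearEquation`, `FlowReduction`) prove; nothing
about any Bałaban paper — the cell's FINAL-STATEMENT (B) («UV stability = bounds on effective actions uniform in the
lattice spacing») is a statement about [Balaban1985UVStability3D]/[Balaban1988Convergent]/[Balaban1989LargeFieldII], of
which (459)–(460) is only the SHAPE in a completed two-dimensional fermionic case: an `N`-uniform bound on the final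
effective action in a Banach-algebra norm and the resulting two-sided bound on the partition function.  Dimock–Yuan is
published and refereed and is part of the cell's TEMPLATE, not a manuscript under audit.  Value = the end statement of
D10 typed and kernel-checked in its mechanism (with Theorems 1–4's outputs as named inputs), closing TEMPLATE.md §16's
statement list for D10; NOT summit progress.

Cell records: TEMPLATE.md §16.2 / §16.5; unit `b2b-balaban-template` gen 26, journal claim D10-THM5-KERNEL.  NEW leaf;
imports the tree's `Literature.Analysis.Calculus.ExpDuhamel` (`norm_exp_sub_one_le`) + Mathlib; modifies nothing.  v1 =
p192547; v1.1 (docstring-only): fold of the cross-read GAPS.md C-adv2-97 (ok — objections 0; DOCFIX D-1: Lemma 1 quoted WITH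
its hypothesis on `𝒞′`; INFO I1: the (456)/(462) sign inconsistency of the print marked ⟦sic⟧; INFO I2: the print's strict
«< ½» is typed as `≤` after the explicit smallness — unchanged).
-/

noncomputable section

open NormedSpace

namespace Literature.MathematicalPhysics.QuantumFieldTheory.DimockYuan2024.StabilityBound

/-! ## Part 1. (459): the bookkeeping `‖S_f‖_h ≤ CC_V g_f` from per-term bounds -/

section Action

variable {𝔸 : Type*} [SeminormedAddCommGroup 𝔸]

/-- (459)'s arithmetic — [DimockYuan2024GNFlow] §5, verbatim: *"All the other terms in S_N are higher order and smaller …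
The bound on S_f follows."*: a finite sum of terms each bounded by `a_i · g` is bounded by `(Σ_i a_i) · g` (the seven
terms of (458) with the constants of (461), (lunar), (lunar1), (twotwotwo) as inputs).
[cite: DimockYuan2024GNFlow, §5 Theorem 5 proof (arXiv:2303.07916v3 TeX L4121–4128)] -/
theorem norm_action_le {ι : Type*} (s : Finset ι) (T : ι → 𝔸) (a : ι → ℝ) (g : ℝ)
    (h : ∀ i ∈ s, ‖T i‖ ≤ a i * g) : ‖∑ i ∈ s, T i‖ ≤ (∑ i ∈ s, a i) * g := by
  calc ‖∑ i ∈ s, T i‖ ≤ ∑ i ∈ s, ‖T i‖ := norm_sum_le _ _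
    _ ≤ ∑ i ∈ s, a i * g := Finset.sum_le_sum h
    _ = (∑ i ∈ s, a i) * g := by rw [Finset.sum_mul]

end Action

section Term

variable {𝔸 : Type*} [SeminormedAddCommGroup 𝔸] [NormedSpace ℝ 𝔸]

/-- The display (461) — *"Then as in lemma 4 with |z_N| ≤ C_Z g_f  ‖z_N ∫ψ̄∂̸ψ‖_h ≤ CC_V g_f"*: for a scalar coefficient
`|z| ≤ C_Z g` in front of a fixed element `M` (the monomial `∫ψ̄∂̸ψ`), `‖z • M‖ ≤ C_Z g ‖M‖` — so the constant of (459)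
for this term is `C_Z ‖∫ψ̄∂̸ψ‖_h`. [cite: DimockYuan2024GNFlow, §5 eq. (461) (arXiv:2303.07916v3 TeX L4122–4125)] -/
theorem norm_smul_term_le {z CZ g : ℝ} (hz : |z| ≤ CZ * g) (M : 𝔸) : ‖z • M‖ ≤ CZ * g * ‖M‖ := by
  rw [norm_smul, Real.norm_eq_abs]
  exact mul_le_mul_of_nonneg_right hz (norm_nonneg _)

end Term

/-! ## Part 2. (462)–(463): `|𝖹 − 1| ≤ e^{‖S_f‖} − 1` in any Banach algebra with a norm-bounded integral -/

section Partition

variable {𝔸 : Type*} [NormedRing 𝔸] [NormedAlgebra ℝ 𝔸] [CompleteSpace 𝔸]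
variable {E : Type*} [SeminormedAddCommGroup E] [NormedSpace ℝ E]

/-- (462)–(463) — [DimockYuan2024GNFlow] §5, verbatim: *"Now we write ∫ e^{−S_f} dμ_{G_f} = 1 + ∫ (e^{−S_f} − 1) dμ_{G_f}
(462)  Estimate the last integral as in lemma 7 and get … |∫ (e^{−S_f} − 1) dμ_{G_f}| ≤ ‖e^{−S_f} − 1‖_{h(G_f)} ≤
e^{‖S_f‖_{h(G_f)}} − 1"* — PROVED MODEL-FREE: for a real-linear `I` on a real Banach algebra with `‖I F‖ ≤ ‖F‖` (Lemma 7,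
l. 1053) and any `S`, `‖I(e^{−S}) − I(1)‖ ≤ e^{‖S‖} − 1` (Banach-algebra step: the tree's
`Literature.Analysis.Calculus.norm_exp_sub_one_le`; Lemma 1, l. 454, is the statement that `𝒢_h` is a Banach algebra).
[cite: DimockYuan2024GNFlow, §5 eqs. (462)–(463) (arXiv:2303.07916v3 TeX L4140–4150)] -/
theorem norm_partition_sub_le (I : 𝔸 →ₗ[ℝ] E) (hI : ∀ F : 𝔸, ‖I F‖ ≤ ‖F‖) (S : 𝔸) :
    ‖I (exp (-S)) - I 1‖ ≤ Real.exp ‖S‖ - 1 := by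
  rw [← map_sub]
  calc ‖I (exp (-S) - 1)‖ ≤ ‖exp (-S) - 1‖ := hI _
    _ ≤ Real.exp ‖-S‖ - 1 := Literature.Analysis.Calculus.norm_exp_sub_one_le (-S)
    _ = Real.exp ‖S‖ - 1 := by rw [norm_neg]

/-- (463) with the proved (459) transported to `h(G_f)` — *"Then ‖S_f‖_{h(G_f)} ≤ ‖S_f‖_h ≤ CC_V g_f … ≤ e^{CC_V g_f} −
1"*: if `‖S‖ ≤ c` then `‖I(e^{−S}) − I(1)‖ ≤ e^{c} − 1`. [cite: DimockYuan2024GNFlow, §5 eq. (463) (arXiv:2303.07916v3 TeX L4138–4150)] -/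
theorem norm_partition_sub_le_of_le (I : 𝔸 →ₗ[ℝ] E) (hI : ∀ F : 𝔸, ‖I F‖ ≤ ‖F‖) {S : 𝔸} {c : ℝ}
    (hS : ‖S‖ ≤ c) : ‖I (exp (-S)) - I 1‖ ≤ Real.exp c - 1 :=
  (norm_partition_sub_le I hI S).trans (by linarith [Real.exp_le_exp.2 hS])

end Partition

/-! ## Part 3. (460): `½ ≤ 𝖹 ≤ 3/2`, the smallness `e^{CC_V g_f} − 1 < ½` made explicit -/

section Real

variable {𝔸 : Type*} [NormedRing 𝔸] [NormedAlgebra ℝ 𝔸] [CompleteSpace 𝔸]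

/-- *"for g_f sufficiently small … e^{CC_V g_f} − 1 < ½"* made explicit: `c ≤ log(3/2)` gives `e^{c} ≤ 3/2`.
[cite: DimockYuan2024GNFlow, §5 eq. (463) (arXiv:2303.07916v3 TeX L4143–4150)] -/
theorem exp_le_three_halves_of_le_log {c : ℝ} (hc : c ≤ Real.log (3 / 2)) : Real.exp c ≤ 3 / 2 := by
  calc Real.exp c ≤ Real.exp (Real.log (3 / 2)) := Real.exp_le_exp.2 hc
    _ = 3 / 2 := Real.exp_log (by norm_num)

/-- **THEOREM 5 (460), MODEL-FREE** — [DimockYuan2024GNFlow] §5, verbatim: *"(Stability bound) Under the hypotheses of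
theorem 1 with parameters chosen as in theorem 4 we have uniformly in N  ‖S_f‖_h ≤ CC_V g_f  and  ½ ≤ 𝖹 ≤ 3/2"*: for a
real Banach algebra `𝔸` (= `𝒢_{h(G_f)}`, Lemma 1), a real-linear integral `I` with `I 1 = 1` and `|I F| ≤ ‖F‖` (Lemma 7),
and an action with `‖S‖ ≤ c`, `e^{c} ≤ 3/2` (= (459) with `CC_V g_f ≤ log(3/2)`), the partition function `𝖹 = I(e^{−S})`
satisfies `½ ≤ 𝖹 ≤ 3/2`; *"uniformly in N"* = the hypotheses carry no `N`.
[cite: DimockYuan2024GNFlow, §5 Theorem 5 (arXiv:2303.07916v3 TeX L4110–4152)] -/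
theorem DimockYuan2024_thm5_stability (I : 𝔸 →ₗ[ℝ] ℝ) (hI1 : I 1 = 1) (hI : ∀ F : 𝔸, ‖I F‖ ≤ ‖F‖)
    {S : 𝔸} {c : ℝ} (hS : ‖S‖ ≤ c) (hc : Real.exp c ≤ 3 / 2) :
    1 / 2 ≤ I (exp (-S)) ∧ I (exp (-S)) ≤ 3 / 2 := by
  have h := norm_partition_sub_le_of_le I hI hS
  rw [hI1, Real.norm_eq_abs] at h
  have h' : |I (exp (-S)) - 1| ≤ 1 / 2 := h.trans (by linarith)
  rw [abs_le] at h'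
  constructor <;> linarith [h'.1, h'.2]

/-- THEOREM 5 with the print's constants: `c = C·C_V·g_f` and the explicit smallness `0 ≤ g_f ≤ log(3/2)/(C·C_V)`
(`C, C_V > 0`) give `½ ≤ 𝖹 ≤ 3/2`. [cite: DimockYuan2024GNFlow, §5 Theorem 5 (arXiv:2303.07916v3 TeX L4110–4152)] -/
theorem DimockYuan2024_thm5_stability_gf (I : 𝔸 →ₗ[ℝ] ℝ) (hI1 : I 1 = 1) (hI : ∀ F : 𝔸, ‖I F‖ ≤ ‖F‖)
    {S : 𝔸} {C CV gf : ℝ} (hC : 0 < C) (hCV : 0 < CV) (hS : ‖S‖ ≤ C * CV * gf)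
    (hgf : gf ≤ Real.log (3 / 2) / (C * CV)) :
    1 / 2 ≤ I (exp (-S)) ∧ I (exp (-S)) ≤ 3 / 2 := by
  refine DimockYuan2024_thm5_stability I hI1 hI hS (exp_le_three_halves_of_le_log ?_)
  have hpos : 0 < C * CV := mul_pos hC hCV
  calc C * CV * gf ≤ C * CV * (Real.log (3 / 2) / (C * CV)) := mul_le_mul_of_nonneg_left hgf hpos.le
    _ = Real.log (3 / 2) := mul_div_cancel₀ _ hpos.ne'

/-- The two-sided bound in the symmetric form `|𝖹 − 1| ≤ e^{c} − 1` (real case). [cite: DimockYuan2024GNFlow, §5 eq. (463) (arXiv:2303.07916v3 TeX L4143–4150)] -/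
theorem abs_partition_sub_one_le (I : 𝔸 →ₗ[ℝ] ℝ) (hI1 : I 1 = 1) (hI : ∀ F : 𝔸, ‖I F‖ ≤ ‖F‖)
    {S : 𝔸} {c : ℝ} (hS : ‖S‖ ≤ c) : |I (exp (-S)) - 1| ≤ Real.exp c - 1 := by
  have h := norm_partition_sub_le_of_le I hI hS
  rwa [hI1, Real.norm_eq_abs] at h

end Real

/-! ## Part 4. Non-vacuity: the hypotheses are consistent and the bound of Part 2 is sharp on `𝔸 = ℝ` -/

section Pins

/-- On `𝔸 = ℝ` with `I = id` (so `I 1 = 1`, `|I F| = ‖F‖`) and `S = c ≥ 0`: `𝖹 = e^{−c}` and Part 2's bound reads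
`|e^{−c} − 1| ≤ e^{c} − 1` — consistent hypotheses (equality at `c = 0`). [folklore] -/
theorem pin_real {c : ℝ} (hc0 : 0 ≤ c) :
    |(LinearMap.id : ℝ →ₗ[ℝ] ℝ) (exp (-c)) - 1| ≤ Real.exp c - 1 :=
  abs_partition_sub_one_le LinearMap.id rfl (fun _ => le_rfl) (S := c)
    (by rw [Real.norm_eq_abs, abs_of_nonneg hc0])

/-- The instance of Theorem 5 on `𝔸 = ℝ`: for `0 ≤ c ≤ log(3/2)`, `½ ≤ e^{−c} ≤ 3/2`. [folklore] -/
theorem pin_real_thm5 {c : ℝ} (hc0 : 0 ≤ c) (hc : c ≤ Real.log (3 / 2)) :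
    1 / 2 ≤ (LinearMap.id : ℝ →ₗ[ℝ] ℝ) (exp (-c)) ∧ (LinearMap.id : ℝ →ₗ[ℝ] ℝ) (exp (-c)) ≤ 3 / 2 :=
  DimockYuan2024_thm5_stability LinearMap.id rfl (fun _ => le_rfl) (S := c)
    (by rw [Real.norm_eq_abs, abs_of_nonneg hc0]) (exp_le_three_halves_of_le_log hc)

end Pins

end Literature.MathematicalPhysics.QuantumFieldTheory.DimockYuan2024.StabilityBound
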